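/-
Origin: expansion seat `prover-pub-hodgecm-mc-binder-2-g19-0`, handover #98 2026-08-20T23:58Z md5 bd99c0ced9e3 (NEW; 217 l.; ns HodgeCM.TwistedCoinv (§1 generic) + HodgeCM.Model.SplitLine (§2) + HodgeCM.Model (§3); K0 RIDERS 1 ∕ 2 AS THEOREMS — necessary conditions the cited sentences of the pinned dictionary liuDictionaryOfWeilFamily(Aut) … ιV I line GoodChar impose on the pin: §1 TwistedCoinv.mk_eq_zero_of_apply_eq_self ∕ subsingleton_of_forall_exists_fixed (χ-coinvariants VANISH when every vector is fixed by some h with χ h ≠ 1); §2 SplitLine.exists_mem_apply_ne_one_of_not_isLevelTrivial, **SplitLine.subsingleton_Ω_of_not_isLevelTrivial** ((R2) in kernel: smooth U(W)(𝔸_f)-member of finPairRepW + χ not level-trivial ⇒ Ω(p,χ) = 0; smoothness = hypothesis hsmooth, open-stabiliser form as sinst-1's finRepZero_smooth); §3 nontrivial_Ω_of_irreducible (Irreducible ⇒ Ω(line i,χ) ≠ 0 for every good χ), not_irreducible_of_subsingleton, **isLevelTrivial_of_irreducible** (RIDER 1: at a smooth line the cited Def. 4.11 FORCES GoodChar ⊆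 IsLevelTrivial), **line_injective_of_muSeparated** (RIDER 2 injectivity half: MuSeparated + one good χ per index ⇒ Function.Injective line), line_injective_of_muSeparated_aut (unconditional at GoodChar := IsAutChar), not_muSeparated_aut_of_line_eq, charW_eq_of_thm418_2, pin_obligations_of_hcite_aut (summary). CERT lane farm lean-direct over g19/farm/mirror = PKG .lake RUN-66 oleans (4 541): rc 0 ∕ 19 s ∕ 0 warn ∕ 0 proof holes (g19/farm/logs/summary.tsv); #print axioms 12 ∕ 12 ⊆ {propext, Classical.choice, Quot.sound}, proof-holeAx 0 (g19/farm/logs/ax_k0.log ec193d20aaa6); FQN 0 ∕ 12 vs headline-decls 688600dbcd01 + PKG sources + theta-3∕sinst-1∕axioms-1∕binder-1∕carch-1 stage6x dirs. NAME LIST (theorems): HodgeCM.Model.SplitLine.subsingleton_Ω_of_not_isLevelTrivial · HodgeCM.Model.isLevelTrivial_of_irreducible · HodgeCM.Model.line_injective_of_muSeparated. (`HOME/mc/pub-hodgecm-mc-binder-2/g19/stage67/HodgeCM/Model/Binders/JLiuK0Necessary.lean`, md5 bd99c0ced9e3, 217 lines);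
landed by the gen-28 packager (p-g28) in gate run 67 as `HodgeCM/Model/Binders/JLiuK0Necessary.lean` (verbatim).
-/
/-
Origin: BINDER seat `prover-pub-hodgecm-mc-binder-2-g19-0` (unit pub-hodgecm-mc-binder-2-g19, gen 19 of mc-binder-2), 2026-08-21.
Target in PKG: `HodgeCM/Model/Binders/JLiuK0Necessary.lean` (NEW additive KERNEL leaf beside E; imports LANDED #6r2
`Model/LiuDictionaryInstanceLevel` only; nothing imports it; outside E's import closure; E `Model/E2InstanceOGR21AEPI.lean`
4c667377ea4b untouched; MODEL-N ±0).
KERNEL ONLY: theorems; 0 defs, 0 records, nothing cited, 0 `def … : Prop`. Nothing here is a claim of the manuscripts under adjudication.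
-/
import Summits.HodgeConjecture.HodgeCM.Model.LiuDictionaryInstanceLevel

set_option autoImplicit false

/-!
# (J3) K0 — what the five CITED sentences FORCE on the pinned index `(I, line, GoodChar)`

The junction-form children of E («T′» ∕ «Ty» ∕ «Ts») carry the hypothesis
`hcite V = Irreducible ∧ Prop413 ∧ Thm418_2 ∧ MuSeparated ∧ Thm418C` of the PINNED dictionary
`liuDictionaryOfWeilFamily … ιV I line GoodChar` (axioms-1 #6r2; `GoodChar := IsAutChar` of record) for EVERY `(L, ι₁, V)`.
A conjunct that is FALSE of the pinned objects makes such a child VACUOUS.  binder-2-g18's K0 RIDERS 1 ∕ 2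
(`K0-CHECKLIST.md`, items (I1a), (M1)) were desk checks on the TEXT of the pin; this leaf turns them into KERNEL obligations,
i.e. theorems «cited sentence ⇒ property of `(I, line, GoodChar)`», so that a pin violating them is refuted by `decide`-free
kernel terms rather than by reading:

* §1 (generic, `HodgeCM.TwistedCoinv`): the `χ`-coinvariants of `ρW` VANISH as soon as every vector is fixed by some `h` with
  `χ h ≠ 1` (`mk_eq_zero_of_apply_eq_self`, `subsingleton_of_forall_exists_fixed`) — the algebra of theta-3-g26's (R2).
* §2 (`HodgeCM.Model.SplitLine`): for a split line `p` whose `U(W)(𝔸_f)`-member of the finite Weil representation is SMOOTH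
  (every Schwartz–Bruhat vector has an open stabiliser — hypothesis `hsmooth`, the `W`-analogue of sinst-1's `finRepZero_smooth`),
  a character `χ` that is NOT level-trivial has `Ω(p, χ) = 0` (`subsingleton_Ω_of_not_isLevelTrivial`).
* §3 (`HodgeCM.Model`, the pinned dictionary `T := liuDictionaryOfWeilFamily … ιV I line GoodChar`):
  (a) `T.Irreducible → GoodChar i χ → Nontrivial (Ω(line i, χ))` (`nontrivial_Ω_of_irreducible`), its contrapositive, and with §2
      **`T.Irreducible → GoodChar i χ → (line i).IsLevelTrivial χ`** at every smooth line (`isLevelTrivial_of_irreducible`) —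
      K0 RIDER 1 as a theorem: the cited [Liu21, Def. 4.11] FORCES the continuity cut;
  (b) **`T.MuSeparated → (∀ i, GoodChar i 1) → Function.Injective line`** (`line_injective_of_muSeparated`), unconditionally at
      `GoodChar := IsAutChar` (`line_injective_of_muSeparated_aut`) — K0 RIDER 2's injectivity half as a theorem: an index listing
      one split line twice refutes `hcite`;
  (c) `T.Thm418_2 → GoodChar i χ → GoodChar i χ' → Ω(line i, χ) ≃ Ω(line i, χ') → χ = χ'` (`charW_eq_of_thm418_2`).
Necessary conditions only; nothing is asserted about any instance.
-/

noncomputable section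

open Function Set
open NumberField
open Literature.AlgebraicGeometry.Motives
open Literature.AlgebraicGeometry.ShimuraVarieties
open Literature.AlgebraicGeometry.HodgeTheory
open Literature.NumberTheory.Automorphic
open Literature.NumberTheory.Automorphic.PicardCM
open Literature.NumberTheory.Weil1964
open Literature.NumberTheory.Transcendental (Arapura2012_Cor_15_4_6)

/-! ## §1. Vanishing of twisted coinvariants (generic) -/

namespace HodgeCM.TwistedCoinv

variable {k : Type*} [Field k] {H S : Type*} [Group H] [AddCommGroup S] [Module k S]
  (ρW : Representation k H S) (χ : H →* kˣ)

/-- a vector FIXED by some `h` with `χ h ≠ 1` dies in the `χ`-coinvariants: `mk v = χ h • mk v` forces `mk v = 0`. [folklore] -/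
theorem mk_eq_zero_of_apply_eq_self {h : H} {v : S} (hv : ρW h v = v) (hχ : χ h ≠ 1) : mk ρW χ v = 0 := by
  have key : ((1 : k) - ((χ h : kˣ) : k)) • mk ρW χ v = 0 := by
    rw [sub_smul, one_smul, ← mk_ρW ρW χ h v, hv, sub_self]
  rcases smul_eq_zero.1 key with h0 | h0
  · exact absurd (Units.val_eq_one.1 (sub_eq_zero.1 h0).symm) hχ
  · exact h0

/-- **the `χ`-coinvariants VANISH** when every vector is fixed by some `h ∈ H` with `χ h ≠ 1`. [folklore] -/
theorem subsingleton_of_forall_exists_fixed (hfix : ∀ v : S, ∃ h : H, ρW h v = v ∧ χ h ≠ 1) :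
    Subsingleton (Coinv ρW χ) := by
  refine subsingleton_of_forall_eq 0 fun x => ?_
  obtain ⟨v, rfl⟩ := mk_surjective ρW χ x
  obtain ⟨h, hv, hχ⟩ := hfix v
  exact mk_eq_zero_of_apply_eq_self ρW χ hv hχ

end HodgeCM.TwistedCoinv

namespace HodgeCM.Model

open HodgeCM.Model.TowerLevel HodgeCM.Model.TowerCarrier HodgeCM.Literature.Theta HodgeCM.Literature.Theta.LiuAlbaneseModuleDatum
open HodgeCM.CMTypeOps (inflate)
open HodgeCM.Universe (ThetaModel)

/-! ## §2. A split line with SMOOTH `U(W)(𝔸_f)`-action: non-level-trivial characters have zero coinvariants -/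

namespace SplitLine

variable {L : CMField} {ι₁ : (L : Type) →+* ℂ} {V : HermSpace3 L ι₁}
  {JV : Matrix (Fin 3) (Fin 3) (L : Type)} {TV : Matrix (Fin 3) (Fin 3) ↥(maximalRealSubfield (L : Type))}
  {δ : (L : Type)} {hcδ : IsCMField.complexConj (L : Type) δ = -δ} {hδ : δ ≠ 0} {d : ↥(maximalRealSubfield (L : Type))}
  {hd : δ * δ = algebraMap _ (L : Type) d} {hV : TV.IsSymm} {hVd : IsUnit TV.det}
  {hJV : JV = TV.map (algebraMap _ (L : Type))}
  (p : SplitLine JV TV hcδ hδ hd hV hVd hJV)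
  (ιV : ↥V.adelicFin →*
    ↥(UnitaryGroup.finAdelic (↥(maximalRealSubfield (L : Type))) (L : Type) (IsCMField.complexConj (L : Type)) 3 JV))

/-- a character that is NOT level-trivial is non-trivial on EVERY open subgroup of `U(W)(𝔸_f)`. [folklore] -/
theorem exists_mem_apply_ne_one_of_not_isLevelTrivial {χ : p.CharW} (hχ : ¬ p.IsLevelTrivial χ)
    {K : Subgroup ↥(UnitaryGroup.finAdelic (↥(maximalRealSubfield (L : Type))) (L : Type)
      (IsCMField.complexConj (L : Type)) 1 p.JW)}
    (hK : IsOpen (K : Set ↥(UnitaryGroup.finAdelic (↥(maximalRealSubfield (L : Type))) (L : Type)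
      (IsCMField.complexConj (L : Type)) 1 p.JW))) :
    ∃ u ∈ K, χ u ≠ 1 := by
  by_contra hall
  push Not at hall
  refine hχ ((p.isLevelTrivial_iff_isOpen_ker χ).2 ?_)
  exact Subgroup.isOpen_mono (fun u hu => (MonoidHom.mem_ker).2 (hall u hu)) hK

/-- **(R2) in kernel**: if the `U(W)(𝔸_f)`-member of the finite Weil representation of `p` is SMOOTH (every Schwartz–Bruhat
vector has an open stabiliser), then for every character `χ` that is NOT level-trivial the coinvariants `Ω(p, χ)` VANISH.
[folklore] -/
theorem subsingleton_Ω_of_not_isLevelTrivial {χ : p.CharW}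
    (hsmooth : ∀ v : FinSB (↥(maximalRealSubfield (L : Type))) (Fin 3 × Fin 1),
      ∃ K : Subgroup ↥(UnitaryGroup.finAdelic (↥(maximalRealSubfield (L : Type))) (L : Type)
        (IsCMField.complexConj (L : Type)) 1 p.JW),
        IsOpen (K : Set ↥(UnitaryGroup.finAdelic (↥(maximalRealSubfield (L : Type))) (L : Type)
          (IsCMField.complexConj (L : Type)) 1 p.JW)) ∧
        ∀ u ∈ K, HodgeCM.WeilCoinv.finPairRepW (↥(maximalRealSubfield (L : Type))) (L : Type)
          (IsCMField.complexConj (L : Type)) 3 1 p.e JV p.JW hcδ hδ hd hV p.hW hVd p.hWd hJV p.hJW p.hs u v = v)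
    (hχ : ¬ p.IsLevelTrivial χ) : Subsingleton (p.Ω ιV χ) := by
  change Subsingleton (HodgeCM.TwistedCoinv.Coinv (HodgeCM.WeilCoinv.finPairRepW (↥(maximalRealSubfield (L : Type)))
    (L : Type) (IsCMField.complexConj (L : Type)) 3 1 p.e JV p.JW hcδ hδ hd hV p.hW hVd p.hWd hJV p.hJW p.hs) χ)
  refine HodgeCM.TwistedCoinv.subsingleton_of_forall_exists_fixed _ χ fun v => ?_
  obtain ⟨K, hK, hfix⟩ := hsmooth v
  obtain ⟨u, hu, hne⟩ := p.exists_mem_apply_ne_one_of_not_isLevelTrivial hχ hK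
  exact ⟨u, hfix u hu, hne⟩

end SplitLine

/-! ## §3. The pinned dictionary: necessary conditions on `(I, line, GoodChar)` -/

variable (hHD : exists_isReal_hodgeModel) (hI : hodgePQ_independent_of_hodgeModel)
  (h₁ : BallQuotientUniformised) (h₃ : CMAbelianVarietyRealised) (hA : Arapura2012_Cor_15_4_6)
variable {L : CMField} {ι₁ : (L : Type) →+* ℂ} (V : HermSpace3 L ι₁)
variable {JV : Matrix (Fin 3) (Fin 3) (L : Type)} {TV : Matrix (Fin 3) (Fin 3) ↥(maximalRealSubfield (L : Type))}
  {δ : (L : Type)} {hcδ : IsCMField.complexConj (L : Type) δ = -δ} {hδ : δ ≠ 0} {d : ↥(maximalRealSubfield (L : Type))}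
  {hd : δ * δ = algebraMap _ (L : Type) d} {hV : TV.IsSymm} {hVd : IsUnit TV.det}
  {hJV : JV = TV.map (algebraMap _ (L : Type))}
  (ιV : ↥V.adelicFin →*
    ↥(UnitaryGroup.finAdelic (↥(maximalRealSubfield (L : Type))) (L : Type) (IsCMField.complexConj (L : Type)) 3 JV))
  (I : Type) (line : I → SplitLine JV TV hcδ hδ hd hV hVd hJV) (GoodCharI : (i : I) → (line i).CharW → Prop)

/-- **(a) `Irreducible` FORCES non-vanishing**: under the cited [Liu21, Def. 4.11] for the pinned dictionary, `Ω(line i, χ) ≠ 0`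
for every good character `χ` of every index line. [folklore] -/
theorem nontrivial_Ω_of_irreducible
    (h : (liuDictionaryOfWeilFamily hHD hI h₁ h₃ hA V ιV I line GoodCharI).Irreducible)
    (i : I) {χ : (line i).CharW} (hχ : GoodCharI i χ) : Nontrivial ((line i).Ω ιV χ) :=
  @IsSimpleModule.nontrivial (adelicAlgebra V) _ ((line i).Ω ιV χ) _ _ (h i ⟨χ, hχ⟩)

/-- contrapositive of (a): ONE good character with vanishing coinvariants refutes `Irreducible` for the pin. [folklore] -/
theorem not_irreducible_of_subsingleton (i : I) {χ : (line i).CharW} (hχ : GoodCharI i χ)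
    [hΩ : Subsingleton ((line i).Ω ιV χ)] :
    ¬ (liuDictionaryOfWeilFamily hHD hI h₁ h₃ hA V ιV I line GoodCharI).Irreducible := fun h =>
  not_nontrivial_iff_subsingleton.2 hΩ (nontrivial_Ω_of_irreducible hHD hI h₁ h₃ hA V ιV I line GoodCharI h i hχ)

/-- **K0 RIDER 1 AS A THEOREM**: at an index line whose `U(W)(𝔸_f)`-action is smooth, the cited `Irreducible` FORCES every good
character to be LEVEL-TRIVIAL (continuous) — a cut `GoodChar` admitting a discontinuous `χ` makes `hcite` false.
[folklore] -/
theorem isLevelTrivial_of_irreducible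
    (h : (liuDictionaryOfWeilFamily hHD hI h₁ h₃ hA V ιV I line GoodCharI).Irreducible) (i : I)
    (hsmooth : ∀ v : FinSB (↥(maximalRealSubfield (L : Type))) (Fin 3 × Fin 1),
      ∃ K : Subgroup ↥(UnitaryGroup.finAdelic (↥(maximalRealSubfield (L : Type))) (L : Type)
        (IsCMField.complexConj (L : Type)) 1 (line i).JW),
        IsOpen (K : Set ↥(UnitaryGroup.finAdelic (↥(maximalRealSubfield (L : Type))) (L : Type)
          (IsCMField.complexConj (L : Type)) 1 (line i).JW)) ∧
        ∀ u ∈ K, HodgeCM.WeilCoinv.finPairRepW (↥(maximalRealSubfield (L : Type))) (L : Type)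
          (IsCMField.complexConj (L : Type)) 3 1 (line i).e JV (line i).JW hcδ hδ hd hV (line i).hW hVd (line i).hWd hJV
          (line i).hJW (line i).hs u v = v)
    {χ : (line i).CharW} (hχ : GoodCharI i χ) : (line i).IsLevelTrivial χ := by
  by_contra hlt
  haveI := (line i).subsingleton_Ω_of_not_isLevelTrivial ιV hsmooth hlt
  exact not_irreducible_of_subsingleton hHD hI h₁ h₃ hA V ιV I line GoodCharI i hχ h

/-- **(b) K0 RIDER 2 (injectivity half) AS A THEOREM**: `MuSeparated` for the pinned dictionary FORCES the line map to be
INJECTIVE, as soon as every index carries one good character (here: the trivial one). [folklore] -/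
theorem line_injective_of_muSeparated
    (hμ : (liuDictionaryOfWeilFamily hHD hI h₁ h₃ hA V ιV I line GoodCharI).MuSeparated)
    (h1 : ∀ i, GoodCharI i 1) : Function.Injective line := by
  intro i i' hii'
  refine hμ i i' ⟨1, h1 i⟩ ⟨1, h1 i'⟩ ?_
  change Nonempty ((line i).Ω ιV 1 ≃ₗ[adelicAlgebra V] (line i').Ω ιV 1)
  have key : ∀ p p' : SplitLine JV TV hcδ hδ hd hV hVd hJV, p = p' →
      Nonempty (p.Ω ιV 1 ≃ₗ[adelicAlgebra V] p'.Ω ιV 1) := by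
    rintro p _ rfl
    exact ⟨LinearEquiv.refl _ _⟩
  exact key _ _ hii'

/-- (b) at the `GoodChar` OF RECORD (`IsAutChar`, which the trivial character satisfies): `MuSeparated` for
`liuDictionaryOfWeilFamilyAut … I line` FORCES `line` injective — unconditionally. [folklore] -/
theorem line_injective_of_muSeparated_aut
    (hμ : (liuDictionaryOfWeilFamilyAut hHD hI h₁ h₃ hA V ιV I line).MuSeparated) : Function.Injective line :=
  line_injective_of_muSeparated hHD hI h₁ h₃ hA V ιV I line (fun i χ => (line i).IsAutChar χ) hμ
    fun i => (line i).isAutChar_one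

/-- a non-injective line map REFUTES `MuSeparated` at the `GoodChar` of record. [folklore] -/
theorem not_muSeparated_aut_of_line_eq {i i' : I} (hne : i ≠ i') (heq : line i = line i') :
    ¬ (liuDictionaryOfWeilFamilyAut hHD hI h₁ h₃ hA V ιV I line).MuSeparated := fun hμ =>
  hne (line_injective_of_muSeparated_aut hHD hI h₁ h₃ hA V ιV I line hμ heq)

/-- **(c) `Thm418_2` on the character subtype**: good characters of ONE index line with isomorphic coinvariants are EQUAL
(as bare homs). [folklore] -/
theorem charW_eq_of_thm418_2
    (h : (liuDictionaryOfWeilFamily hHD hI h₁ h₃ hA V ιV I line GoodCharI).Thm418_2) (i : I)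
    {χ χ' : (line i).CharW} (hχ : GoodCharI i χ) (hχ' : GoodCharI i χ')
    (e : Nonempty ((line i).Ω ιV χ ≃ₗ[adelicAlgebra V] (line i).Ω ιV χ')) : χ = χ' :=
  congrArg Subtype.val (h i ⟨χ, hχ⟩ ⟨χ', hχ'⟩ e)

/-- **SUMMARY at the pin of record** (`GoodChar := IsAutChar`): the cited `Irreducible ∧ MuSeparated` force
`line` injective AND `Ω(line i, χ) ≠ 0` for every automorphic `χ` of every index line. [folklore] -/
theorem pin_obligations_of_hcite_aut
    (hirr : (liuDictionaryOfWeilFamilyAut hHD hI h₁ h₃ hA V ιV I line).Irreducible)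
    (hμ : (liuDictionaryOfWeilFamilyAut hHD hI h₁ h₃ hA V ιV I line).MuSeparated) :
    Function.Injective line ∧ ∀ (i : I) (χ : (line i).CharW), (line i).IsAutChar χ → Nontrivial ((line i).Ω ιV χ) :=
  ⟨line_injective_of_muSeparated_aut hHD hI h₁ h₃ hA V ιV I line hμ, fun i _ hχ =>
    nontrivial_Ω_of_irreducible hHD hI h₁ h₃ hA V ιV I line (fun i χ => (line i).IsAutChar χ) hirr i hχ⟩

end HodgeCM.Model

end
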